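/- Copyright: the b2b-balaban cell (near-miss cell 7), T⁴-continuum fan-out, lineage t4-ne7b-p1 (node U5c COUNT
member).  Released under the licence of the surrounding project. -/
import Summits.QuantumFields.BalabanUV.T4Continuum.Support.HistoryBankingPedigreeLedger
import Summits.QuantumFields.BalabanUV.T4Continuum.Support.HistoryBankingYoungBirth

/-!
# M5-1b (A3c, third brick) — THE BIRTHS' BOOKINGS ALONG A PEDIGREE: the young volume of a realised structure and the
recent-birth fees against the births' own performed bookings, and those against the tagged genealogy's `costT` (owner
module of row NE7b, lineage `t4-ne7b-p1` gen 43; re-open object (α), `SCOPE-alpha.md` v2.6, ruling R-OWNER-43-1 «THE FLAT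
ANCHOR LEDGER» (e), YOUNG and FEE terms; PRE-POSITIONING ONLY)

Summits-side support leaf of the T⁴-continuum cell (rung (B)+1 on a FINITE torus only; NOT infinite volume, NOT the
mass gap, NOT the Clay statement; NOT a proof of the spine estimate NE7b — the cell's OWN estimate, NOT PRINTED, NOT
PROVED).  [folklore] finite sums over `HistoryAdmissible.PGen` ∕ `HistoryRealiseWeak.RealisesW`, A3b's recursive
`youngVol` ∕ `recent` (`HistoryBankingPedigreeLedger`), A3c-young's `HistoryBankingYoungBirth.sum_young_le_booked` (M5-1a
underneath), the booked tables `T4TaggedShapeBanking.costT` (`costT_born`, `costT_renew_eq`, `costT_merge_eq`) ∕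
`T4PrintedShapeBanking.{floorK, wfloor, sz}` and `T4BranchingRecordsGas.relabel`; nothing printed is asserted, no
cite-tagged hypothesis, zero `sorry`.  Three `def`s (`bsum`, `bfee`, `blin`) are recursive finite sums over the pedigree.
B16 = [Balaban1989LargeFieldII] pp. 384–385 under audit; locators only.

WHY (ruling R-OWNER-43-1 (e), journal «RULING R-OWNER-43-1»).  The flat ledger's total (A2 `flat_total_le`) has three
sources: YOUNG, FEE (per recent birth), FLOOR (per component-step; `HistoryBankingFloors`).  THIS FILE books the first two
against the structure's births: §1 **`bsum C K R P n`** — the sum over the births of `P` of their window floor and size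
cost at step `n` (`wfloor C K R j (j,0,cls) n + sz C K R (j,0,cls) n`), with **`bsum_le_costT`**: for a well-formed tagged
genealogy `G` with `relabel sh G = P.toGen`, `bsum C K R P n ≤ costT sh C K R G n` (births are events of `G` placed at
their steps with birth shapes; the other events book nonnegative amounts), and **`sum_bsum_le_lifeCost`** (performed steps
of a structure pending at `K` lie in the booked life); §2 **`sum_youngVol_le`** — the structure's weighted young volume
over the performed steps is at most `2^d·4·blin u P` (the class-linear birth levels, `blin u P = Σ_b u_{j_b}·(cls_b + 1)`,
to the credit-slack factor) plus `Σ_{n ≤ K} bsum C K R P n` (A3c-young per birth, by recursion); §3 **`sum_recent_le_bfee`**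
— the recent-birth counts weighted and summed are at most `j·L_u·bfee u P` (`bfee u P = Σ_b u_{j_b}`; each birth is recent
for `j` steps; growth display `u (t+i) ≤ L_u·u t`, `i < j`) and **`bfee_mul_le_sum_bsum`**: `bfee`, weighted by the
display `u_t·Φ ≤ floorK C K R t` at performed steps, is at most `Σ_{n ≤ K} bsum C K R P n` (each birth's window starts at
its own step).

WHAT IS *NOT* DONE HERE.  The assembly (A3c-final: A2 `flat_total_le` with A3b `perStep`, this file, `HistoryBankingFloors`,
the choice of the lag `j` and the consolidated display) and M5-2.  HONEST: bookkeeping over the lineage's own ledger;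
NE7b NOT proved; spine 0∕9.  HONEST DEPENDENCY (cell): continuum YM on T⁴ ⇐ BetaPertH ∧ nine spine estimates (0∕9
proved); BetaPertH ⇐ (D1) ∧ (D4) ∧ CAP+tail.  This file changes none of it.
-/

open Finset
open Literature.MathematicalPhysics.QuantumFieldTheory.Balaban1983to89
open Literature.MathematicalPhysics.QuantumFieldTheory.Balaban1983to89.B13ScaleTransfer
open Literature.MathematicalPhysics.QuantumFieldTheory.Balaban1983to89.TreeLength
open Literature.MathematicalPhysics.QuantumFieldTheory.Balaban1983to89.B16SProfile
open Literature.MathematicalPhysics.QuantumFieldTheory.Balaban1983to89.B16StoppingRule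
open T4PersistenceDictionary T4PrintedShapeBanking T4TaggedShapeBanking T4BankedInduction T4BranchingRecordsGas
open Summit.QuantumFields.BalabanUV.T4Continuum.HistoryAdmissible
open Summit.QuantumFields.BalabanUV.T4Continuum.HistoryRealise
open Summit.QuantumFields.BalabanUV.T4Continuum.HistoryRealiseWeak
open Summit.QuantumFields.BalabanUV.T4Continuum.HistoryBankingPedigreeLedger
open Summit.QuantumFields.BalabanUV.T4Continuum.HistoryBankingYoungBirth

namespace Summit.QuantumFields.BalabanUV.T4Continuum.HistoryBankingBirthBookings

noncomputable section

open scoped Classical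

variable {d : ℕ} {γ : Type*} {ε : Type*} [DecidableEq ε]

/-! ## §1 The births' bookings along the pedigree, against the tagged genealogy's `costT` -/

section Bookings

variable (C : T4PrintedShapeBanking.Consts) (K : ℕ) (R : ℕ → ℕ)

/-- **THE BIRTHS' BOOKINGS AT STEP `n`**: the sum over the births of the pedigree of the birth event's window floor
(placed at the birth step) and size cost at `n`. [folklore] -/
def bsum : PGen γ → ℕ → ℝ
  | .birth j cls _, n => wfloor C K R j ((j, 0, cls) : PEv) n + sz C K R ((j, 0, cls) : PEv) n
  | .renew G _, n => bsum G n
  | .join X Y _, n => bsum X n + bsum Y n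

variable {C K R}

/-- the births' bookings are nonnegative (`E₂, E₃ ≥ 0`) [folklore] -/
theorem bsum_nonneg (hE₂ : 0 ≤ C.E₂) (hE₃ : 0 ≤ C.E₃) : ∀ (P : PGen γ) (n : ℕ), 0 ≤ bsum C K R P n
  | .birth _ _ _, _ => add_nonneg (wfloor_nonneg hE₂ _ _ _) (sz_nonneg hE₃ _ _)
  | .renew G _, n => bsum_nonneg hE₂ hE₃ G n
  | .join X Y _, n => add_nonneg (bsum_nonneg hE₂ hE₃ X n) (bsum_nonneg hE₂ hE₃ Y n)

/-- **THE BIRTHS' BOOKINGS ARE PART OF THE TAGGED GENEALOGY'S BOOKED COST**: for a well-formed tagged genealogy `G`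
whose shape-relabelling is `P`'s canonical genealogy, `bsum C K R P n ≤ costT sh C K R G n` at every step
(`costT_born` ∕ `costT_renew_eq` ∕ `costT_merge_eq`; the non-birth events book nonnegative amounts). [folklore] -/
theorem bsum_le_costT {sh : ε → PEv} (hE₂ : 0 ≤ C.E₂) (hE₃ : 0 ≤ C.E₃) :
    ∀ (P : PGen γ) (G : Gen ε), relabel sh G = P.toGen → G.WF (dictWT sh R C.n₁) → ∀ (n : ℕ),
      bsum C K R P n ≤ costT sh C K R G n
  | .birth j cls z, G, hsh, hW, n => by
      obtain ⟨b, j', rfl⟩ : ∃ b j', G = Gen.born b j' := by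
        cases G with
        | born b j' => exact ⟨b, j', rfl⟩
        | renew _ _ _ => simp [PGen.toGen] at hsh
        | merge _ _ _ => simp [PGen.toGen] at hsh
      simp only [PGen.toGen, relabel_born, Gen.born.injEq] at hsh
      obtain ⟨hb, rfl⟩ := hsh
      rw [costT_born, hb]
      exact le_rfl
  | .renew Q h, G, hsh, hW, n => by
      obtain ⟨G', e, h', rfl⟩ : ∃ G' e h', G = Gen.renew G' e h' := by
        cases G with
        | born _ _ => simp [PGen.toGen] at hsh
        | renew G' e h' => exact ⟨G', e, h', rfl⟩
        | merge _ _ _ => simp [PGen.toGen] at hsh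
      simp only [PGen.toGen, relabel_renew, Gen.renew.injEq] at hsh
      simp only [Gen.WF] at hW
      rw [costT_renew_eq hW.2.1]
      have ih := bsum_le_costT hE₂ hE₃ Q G' hsh.1 hW.1 n
      have h0 : 0 ≤ wfloor C K R (h' + 1) (sh e) n + sz C K R (sh e) n :=
        add_nonneg (wfloor_nonneg hE₂ _ _ _) (sz_nonneg hE₃ _ _)
      change bsum C K R Q n ≤ _
      linarith
  | .join X Y sj, G, hsh, hW, n => by
      obtain ⟨GX, GY, e, rfl⟩ : ∃ GX GY e, G = Gen.merge GX GY e := by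
        cases G with
        | born _ _ => simp [PGen.toGen] at hsh
        | renew _ _ _ => simp [PGen.toGen] at hsh
        | merge GX GY e => exact ⟨GX, GY, e, rfl⟩
      simp only [PGen.toGen, relabel_merge, Gen.merge.injEq] at hsh
      simp only [Gen.WF] at hW
      obtain ⟨hWX, hWY, heX, heY, hXY, -, -⟩ := hW
      rw [costT_merge_eq heX heY hXY]
      have ihX := bsum_le_costT hE₂ hE₃ X GX hsh.1 hWX n
      have ihY := bsum_le_costT hE₂ hE₃ Y GY hsh.2.1 hWY n
      have h0 : 0 ≤ wfloor C K R (max (GX.reach (dictWT sh R C.n₁)) (GY.reach (dictWT sh R C.n₁))) (sh e) n +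
          sz C K R (sh e) n := add_nonneg (wfloor_nonneg hE₂ _ _ _) (sz_nonneg hE₃ _ _)
      change bsum C K R X n + bsum C K R Y n ≤ _
      linarith

/-- a birth books nothing before its step [folklore] -/
theorem bsum_eq_zero_of_lt : ∀ (P : PGen γ) {n : ℕ}, n < P.rootStep → bsum C K R P n = 0
  | .birth j cls _, n, h => by
      simp only [PGen.rootStep] at h
      change wfloor C K R j ((j, 0, cls) : PEv) n + sz C K R ((j, 0, cls) : PEv) n = 0
      rw [wfloor_of_not_mem (by rw [Finset.mem_Ico]; omega)]
      unfold sz supp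
      rw [if_neg (by rw [Finset.mem_Ioc, PEv.step_mk]; omega), add_zero]
  | .renew G _, n, h => bsum_eq_zero_of_lt G h
  | .join X Y _, n, h => by
      simp only [PGen.rootStep, lt_min_iff] at h
      change bsum C K R X n + bsum C K R Y n = 0
      rw [bsum_eq_zero_of_lt X h.1, bsum_eq_zero_of_lt Y h.2, add_zero]

/-- **THE BIRTHS' PERFORMED BOOKINGS LIE IN THE BOOKED LIFE COST**: for a structure pending at `K` (`K < reach`),
`Σ_{n ≤ K} bsum C K R P n ≤ lifeCost (dictWT sh R C.n₁) (costT sh C K R) G`. [folklore] -/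
theorem sum_bsum_le_lifeCost {sh : ε → PEv} (hE₂ : 0 ≤ C.E₂) (hE₃ : 0 ≤ C.E₃) {P : PGen γ} {G : Gen ε}
    (hsh : relabel sh G = P.toGen) (hW : G.WF (dictWT sh R C.n₁)) (hK : K < G.reach (dictWT sh R C.n₁)) :
    ∑ n ∈ Finset.range (K + 1), bsum C K R P n ≤ lifeCost (dictWT sh R C.n₁) (costT sh C K R) G := by
  have hroot : G.rootStep = P.rootStep := by rw [← rootStep_relabel sh G, hsh, PGen.rootStep_toGen]
  have hterm : ∀ n ∈ Finset.range (K + 1), bsum C K R P n ≤ if G.rootStep ≤ n then costT sh C K R G n else 0 := by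
    intro n _
    split_ifs with hrn
    · exact bsum_le_costT hE₂ hE₃ P G hsh hW n
    · rw [bsum_eq_zero_of_lt P (by omega)]
  refine (Finset.sum_le_sum hterm).trans ?_
  rw [← Finset.sum_filter]
  unfold lifeCost life
  refine Finset.sum_le_sum_of_subset_of_nonneg (fun n hn => ?_) fun n _ _ => costT_nonneg hE₂ hE₃ G n
  simp only [Finset.mem_filter, Finset.mem_range] at hn
  rw [Finset.mem_Ico]
  omega

end Bookings

/-! ## §2 The structure's young volume against its births' bookings -/

section Young

variable {L : ℕ} {s R : ℕ → ℕ} {C : T4PrintedShapeBanking.Consts} {K : ℕ}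

/-- **THE CLASS-LINEAR CONTENT OF THE BIRTHS, WEIGHTED**: `Σ_b u_{j_b}·(cls_b + 1)`. [folklore] -/
def blin (u : ℕ → ℝ) : PGen γ → ℝ
  | .birth j cls _ => u j * ((cls : ℝ) + 1)
  | .renew G _ => blin u G
  | .join X Y _ => blin u X + blin u Y

/-- the class-linear content is nonnegative for `u ≥ 0` [folklore] -/
theorem blin_nonneg {u : ℕ → ℝ} (hu : ∀ n, 0 ≤ u n) : ∀ P : PGen γ, 0 ≤ blin u P
  | .birth j cls _ => mul_nonneg (hu j) (by positivity)
  | .renew G _ => blin_nonneg hu G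
  | .join X Y _ => add_nonneg (blin_nonneg hu X) (blin_nonneg hu Y)

/-- the class-linear content is linear in the weights [folklore] -/
theorem blin_smul (a : ℝ) (u : ℕ → ℝ) : ∀ P : PGen γ, blin (fun n => a * u n) P = a * blin u P
  | .birth j cls _ => by unfold blin; ring
  | .renew G _ => blin_smul a u G
  | .join X Y _ => by
      change blin (fun n => a * u n) X + blin (fun n => a * u n) Y = a * (blin u X + blin u Y)
      rw [blin_smul a u X, blin_smul a u Y]; ring

/-- **THE YOUNG VOLUME OF A REALISED STRUCTURE IS BOOKED BY ITS BIRTHS** (A3c-young per birth, summed along the pedigree):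
flow `L ≥ 4` with drop control on every horizon, sizes `R ≥ 1`, `E₂, E₃ ≥ 0`, unit costs `u ≥ 0` displayed as in M5-1a;
`Σ_{m ≤ K} u_m·youngVol P m ≤ 2^d·4·blin u P + Σ_{n ≤ K} bsum C K R P n`. [folklore] -/
theorem sum_youngVol_le (hL : 4 ≤ L) (hdrop : ∀ m, DropCtl s m) (hR : ∀ t, 1 ≤ R t) (hE₂ : 0 ≤ C.E₂)
    (hE₃ : 0 ≤ C.E₃) {u : ℕ → ℝ} (hu : ∀ n, 0 ≤ u n)
    (huE₂ : ∀ n, n ≤ K → u n * (5 * 126 ^ d) ≤ C.E₂ * (R n : ℝ) ^ C.q')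
    (huE₃ : ∀ n, n ≤ K → u n * (8 * 126 ^ d) ≤ C.E₃ * (R n : ℝ) ^ C.q') {R' : ℕ → ℕ} :
    ∀ (P : PGen (Pt d × Finset (Pt d))) (Z : Finset (Pt d)), RealisesW L s R' P Z →
      ∑ m ∈ Finset.range (K + 1), u m * youngVol L s P m ≤
        2 ^ d * 4 * blin u P + ∑ n ∈ Finset.range (K + 1), bsum C K R P n
  | .birth j cls zZ, Z, hP => by
      obtain ⟨hZ, hc, hZc, hd⟩ := hP
      have hne : zZ.2.Nonempty := ⟨zZ.1, by rw [hZ]; exact hc⟩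
      have hZc' : FaceConnected zZ.2 := by rw [hZ]; exact hZc
      have hd' : treeLen zZ.2 ≤ cls := by rw [hZ]; exact hd
      have h := sum_young_le_booked (s := s) hL hdrop hne hZc' hd' hR hE₂ hE₃ hu huE₂ huE₃ j
      have e1 : ∀ m, u m * youngVol L s (PGen.birth j cls zZ) m = u m *
          (if j ≤ m ∧ ∀ i, i ≤ m - j → ¬ CondI 100 (orbit L s j zZ.2 i) then
            ((orbit L s j zZ.2 (m - j)).card : ℝ) else 0) := fun m => by unfold youngVol; rfl
      simp only [e1]
      refine h.trans (le_of_eq ?_)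
      unfold blin bsum
      ring
  | .renew Q h, Z, hP => by
      obtain ⟨ZQ, hQ, -⟩ := hP
      exact sum_youngVol_le hL hdrop hR hE₂ hE₃ hu huE₂ huE₃ Q ZQ hQ
  | .join X Y sj, Z, hP => by
      obtain ⟨ZX, ZY, hX, hY, -⟩ := hP
      have ihX := sum_youngVol_le hL hdrop hR hE₂ hE₃ hu huE₂ huE₃ X ZX hX
      have ihY := sum_youngVol_le hL hdrop hR hE₂ hE₃ hu huE₂ huE₃ Y ZY hY
      have e1 : ∀ m, u m * youngVol L s (PGen.join X Y sj) m = u m * youngVol L s X m + u m * youngVol L s Y m :=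
        fun m => by rw [youngVol_join]; ring
      simp only [e1, Finset.sum_add_distrib]
      have e2 : ∑ n ∈ Finset.range (K + 1), bsum C K R (PGen.join X Y sj) n =
          ∑ n ∈ Finset.range (K + 1), bsum C K R X n + ∑ n ∈ Finset.range (K + 1), bsum C K R Y n := by
        rw [← Finset.sum_add_distrib]; rfl
      rw [e2]
      change _ ≤ 2 ^ d * 4 * (blin u X + blin u Y) + _
      linarith

end Young

/-! ## §3 The recent-birth fees against the births' bookings -/

section Fee

variable {C : T4PrintedShapeBanking.Consts} {K : ℕ} {R : ℕ → ℕ}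

/-- **THE BIRTH FEES, WEIGHTED**: `Σ_b u_{j_b}`. [folklore] -/
def bfee (u : ℕ → ℝ) : PGen γ → ℝ
  | .birth j _ _ => u j
  | .renew G _ => bfee u G
  | .join X Y _ => bfee u X + bfee u Y

/-- the weighted fee is nonnegative for `u ≥ 0` [folklore] -/
theorem bfee_nonneg {u : ℕ → ℝ} (hu : ∀ n, 0 ≤ u n) : ∀ P : PGen γ, 0 ≤ bfee u P
  | .birth j _ _ => hu j
  | .renew G _ => bfee_nonneg hu G
  | .join X Y _ => add_nonneg (bfee_nonneg hu X) (bfee_nonneg hu Y)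

/-- **EACH BIRTH IS RECENT FOR `j` STEPS**: with the growth display `u (t + i) ≤ L_u·u t` (`i < j`),
`Σ_{m ≤ K} u_m·recent P (m − j) m ≤ j·L_u·bfee u P`. [folklore] -/
theorem sum_recent_le_bfee {u : ℕ → ℝ} (hu : ∀ n, 0 ≤ u n) {Lu : ℝ} {j : ℕ}
    (hLu : ∀ t i, i < j → u (t + i) ≤ Lu * u t) :
    ∀ P : PGen (Pt d × Finset (Pt d)),
      ∑ m ∈ Finset.range (K + 1), u m * (recent P (m - j) m : ℝ) ≤ j * Lu * bfee u P
  | .birth jb cls zZ => by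
      -- the birth at `jb` is recent exactly at the steps `jb ≤ m < jb + j`
      have hterm : ∀ m ∈ Finset.range (K + 1), u m * (recent (PGen.birth jb cls zZ) (m - j) m : ℝ) ≤
          if m ∈ Finset.Ico jb (jb + j) then u m else 0 := by
        intro m _
        unfold recent
        by_cases hm : m - j < jb ∧ jb ≤ m
        · rw [if_pos hm, if_pos (by rw [Finset.mem_Ico]; omega)]; simp
        · rw [if_neg hm]
          split_ifs
          · simpa using hu m
          · simp
      refine (Finset.sum_le_sum hterm).trans ?_
      rw [← Finset.sum_filter]
      calc ∑ m ∈ (Finset.range (K + 1)).filter (fun m => m ∈ Finset.Ico jb (jb + j)), u m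
          ≤ ∑ m ∈ Finset.Ico jb (jb + j), u m :=
            Finset.sum_le_sum_of_subset_of_nonneg (fun m hm => (Finset.mem_filter.1 hm).2) fun m _ _ => hu m
        _ = ∑ i ∈ Finset.range j, u (jb + i) := by rw [Finset.sum_Ico_eq_sum_range, Nat.add_sub_cancel_left]
        _ ≤ ∑ i ∈ Finset.range j, Lu * u jb :=
            Finset.sum_le_sum fun i hi => hLu jb i (Finset.mem_range.1 hi)
        _ = j * Lu * bfee u (PGen.birth jb cls zZ) := by
            rw [Finset.sum_const, Finset.card_range, nsmul_eq_mul]; unfold bfee; ring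
  | .renew G h => by
      have ih := sum_recent_le_bfee hu hLu G
      have e1 : ∀ m, (recent (PGen.renew G h) (m - j) m : ℝ) = recent G (m - j) m := fun m => rfl
      simp only [e1]; exact ih
  | .join X Y sj => by
      have ihX := sum_recent_le_bfee hu hLu X
      have ihY := sum_recent_le_bfee hu hLu Y
      have e1 : ∀ m, u m * (recent (PGen.join X Y sj) (m - j) m : ℝ) =
          u m * (recent X (m - j) m : ℝ) + u m * (recent Y (m - j) m : ℝ) := fun m => by
        rw [recent_join]; push_cast; ring
      simp only [e1, Finset.sum_add_distrib]
      change _ ≤ j * Lu * (bfee u X + bfee u Y)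
      linarith

/-- **THE FEES ARE BOOKED BY THE BIRTHS' FIRST FLOORS**: with the display `u_t·Φ ≤ floorK C K R t` at every step (at
unperformed steps `floorK = 0` forces `u_t = 0` — the display is asked only where it is used, `t ≤ K`, by restricting
to structures observed by the cutoff: every birth step is `≤ K` under `Adm K`), `Φ·bfee u P ≤ Σ_{n ≤ K} bsum C K R P n`
— each birth's window starts at its own step with the floor `floorK`. [folklore] -/
theorem bfee_mul_le_sum_bsum (hE₂ : 0 ≤ C.E₂) (hE₃ : 0 ≤ C.E₃) {u : ℕ → ℝ} {Φ : ℝ}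
    (huΦ : ∀ t, t ≤ K → u t * Φ ≤ floorK C K R t) (hR : ∀ t, 1 ≤ R t) :
    ∀ (P : PGen γ), P.Adm K → Φ * bfee u P ≤ ∑ n ∈ Finset.range (K + 1), bsum C K R P n
  | .birth j cls z, hA => by
      have hjK : j ≤ K := hA
      have h1 : Φ * bfee u (PGen.birth j cls z) ≤ floorK C K R j := by
        unfold bfee; rw [mul_comm]; exact huΦ j hjK
      have h2 : floorK C K R j ≤ bsum C K R (PGen.birth j cls z) j := by
        change floorK C K R j ≤ wfloor C K R j ((j, 0, cls) : PEv) j + sz C K R ((j, 0, cls) : PEv) j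
        rw [wfloor_of_mem (K := K) (by rw [Finset.mem_Ico, dictW_birth]; have := hR j; omega)]
        linarith [sz_nonneg (K := K) (R := R) hE₃ ((j, 0, cls) : PEv) j]
      have h3 : bsum C K R (PGen.birth j cls z) j ≤ ∑ n ∈ Finset.range (K + 1), bsum C K R (PGen.birth j cls z) n :=
        Finset.single_le_sum (fun n _ => bsum_nonneg hE₂ hE₃ _ n) (Finset.mem_range.2 (by omega))
      linarith
  | .renew G h, hA => by
      simp only [PGen.Adm] at hA
      exact bfee_mul_le_sum_bsum hE₂ hE₃ huΦ hR G hA.1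
  | .join X Y sj, hA => by
      simp only [PGen.Adm] at hA
      have ihX := bfee_mul_le_sum_bsum hE₂ hE₃ huΦ hR X hA.1
      have ihY := bfee_mul_le_sum_bsum hE₂ hE₃ huΦ hR Y hA.2.1
      have e2 : ∑ n ∈ Finset.range (K + 1), bsum C K R (PGen.join X Y sj) n =
          ∑ n ∈ Finset.range (K + 1), bsum C K R X n + ∑ n ∈ Finset.range (K + 1), bsum C K R Y n := by
        rw [← Finset.sum_add_distrib]; rfl
      rw [e2]
      change Φ * (bfee u X + bfee u Y) ≤ _
      nlinarith

end Fee

end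

end Summit.QuantumFields.BalabanUV.T4Continuum.HistoryBankingBirthBookings
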